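import Summits.KontsevichZagierPeriods.KontsevichZagierPeriods.Theorems.LinRedNormalFormArrangementNormalFormStubRebaseSimpleZeroNestedFinal

/-!
# Stub `stub_rebaseSimpleZeroTwo`, part `rebaseSimpleZero_nestedDifferent` (crux
`ArrangementNormalForm`, line `janus-bands`) — brick `NestedDiffCells`

Order-constrained representations with the literal `GG` integrand are GOOD as soon as every
literal cell is good (`RebaseDiff.goodCells`: the total-order refinement of
`RebasePos.orderCells`, rule 1a, with the conclusion "congruent to the target subgroup" taken
as a hypothesis on the literal cells instead of literal membership). Over a one-dimensional
base with two fibres, a simple base pole and letters of a COMMON `y`-slope, EVERY literal cell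
is good for `GG 0 2 2` (`RebaseDiff.good_any`: a cell with a mutual bound is the landed
`rebaseSimpleZero_nestedCommonMain`, a cell without is the landed product case
`RebaseZero.good_literal`, a self-bounded cell is empty); hence every bounded order-constrained
representation with such an integrand is good (`RebaseDiff.good_constraints`, registered as
`rebaseSimpleZero_goodCells`). This is the packaging step after the frame change of variables
of the edge expansion, whose image polytope is cut out by finitely many comparisons between
players but is not literally a cell.

References: M. Kontsevich, D. Zagier, *Periods* (2001), §1.2, rule (1a).
-/

noncomputable section

open Set MeasureTheory MvPolynomial
open Literature.NumberTheory.Transcendental Literature.ModelTheory.ExponentialFields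

namespace Summit.KontsevichZagierPeriods.ArrangementNormalForm.JanusBands

namespace RebaseDiff

open SeparatePos RebasePos RebaseZero RebaseNest IntegrateOutLow

section Cells

variable {b K m n₁ n₂ : ℕ}

/-- **Order-constrained representations are good when their literal cells are.** Let the
domain of `s` be cut out by finitely many strict comparisons between players (fibres `tᵢ` and
affine forms of the base), every fibre compared at least once from below and from above, and
let the integrand be the literal `GG` integrand. If every bounded representation with a
LITERAL domain (`SeparatePos.gDom`) and the same integrand is congruent modulo `KZ.relations`
to the subgroup generated by `G`, so is `s` (rule 1a: total-order refinement; inconsistent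
chains have empty cells). [Kontsevich–Zagier 2001, §1.2, rule (1a)] -/
theorem goodCells (s : KZ.IntegralRep (b + 1 + K))
    (C : Finset ((Fin K ⊕ ((Fin (b + 1) → ℚ) × ℚ)) × (Fin K ⊕ ((Fin (b + 1) → ℚ) × ℚ))))
    (L : Fin m → (Fin b → ℚ) × ℚ) (e : Fin m → ℕ) (p : MvPolynomial (Fin b) ℚ)
    (ℓ₁ ℓ₂ : (Fin b → ℚ) × ℚ) (a : Fin K → Option ((Fin (b + 1) → ℚ) × ℚ))
    (hbd : Bornology.IsBounded s.domain)
    (hlu : ∀ v, (∃ q ∈ C, q.2 = Sum.inl v) ∧ (∃ q ∈ C, q.1 = Sum.inl v))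
    (hdom : s.domain = {z | ∀ q ∈ C, pv q.1 z < pv q.2 z})
    (hint : EqOn s.integrand (glit b K p L e ℓ₁ ℓ₂ n₁ n₂ a) s.domain) (G : Set KZ.FormalRep)
    (HG : ∀ (m' : ℕ) (s' : KZ.IntegralRep (b + 1 + K)) (M : Fin m' → (Fin (b + 1) → ℚ) × ℚ)
      (lo hi : Fin K → Fin K ⊕ ((Fin (b + 1) → ℚ) × ℚ)), Bornology.IsBounded s'.domain →
      s'.domain = gDom b K m' M lo hi → EqOn s'.integrand (glit b K p L e ℓ₁ ℓ₂ n₁ n₂ a) s'.domain →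
      ∃ c ∈ AddSubgroup.closure G, KZ.of s' - c ∈ KZ.relations) :
    ∃ c ∈ AddSubgroup.closure G, KZ.of s - c ∈ KZ.relations := by
  -- adapted from `RebasePos.orderCells` (…StubRebaseSimplePosCells): same refinement, the
  -- literal membership of a consistent cell replaced by the hypothesis `HG`
  classical
  set A : Finset ((Fin (b + 1) → ℚ) × ℚ) :=
    C.biUnion fun q => q.1.getRight?.toFinset ∪ q.2.getRight?.toFinset with hA_def
  have hA : ∀ q ∈ C, ∀ d, (q.1 = Sum.inr d ∨ q.2 = Sum.inr d) → d ∈ A := by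
    intro q hq d h
    rw [hA_def, Finset.mem_biUnion]
    refine ⟨q, hq, ?_⟩
    rcases h with h | h <;> simp [h]
  set P : Fin K ⊕ A → MvPolynomial (Fin (b + 1 + K)) ℚ := fun x =>
    Sum.elim (fun v => (X (Fin.natAdd (b + 1) v) : MvPolynomial (Fin (b + 1 + K)) ℚ))
      (fun d => rename (Fin.castAdd K) (∑ i, MvPolynomial.C (d.1 i) * X i + MvPolynomial.C d.2))
      (Sum.map id Subtype.val x) with hP_def
  have hval : ∀ x z, aeval z (P x) = pv (Sum.map id Subtype.val x) z := fun x z =>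
    aeval_player _ z
  have hP : ∀ x y, x ≠ y → ∃ z, aeval z (P x) ≠ aeval z (P y) := fun x y hxy => by
    obtain ⟨z, hz⟩ := player_ne (b := b + 1) (K := K) (fun h => hxy
      (Sum.map_injective.2 ⟨fun _ _ h => h, Subtype.val_injective⟩ h))
    exact ⟨z, by rwa [hval, hval]⟩
  have hsplit := of_sub_sum_cell_mem_relations P hP s
  have hcell : ∀ σ : Fin (Fintype.card (Fin K ⊕ A)) ≃ Fin K ⊕ A,
      {z : Fin (b + 1 + K) → ℝ | StrictMono fun i => aeval z (P (σ i))} =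
      {z | StrictMono fun i => pv (Sum.map id Subtype.val (σ i)) z} := fun σ => by
    simp_rw [hval]
  set piece := fun σ : Fin (Fintype.card (Fin K ⊕ A)) ≃ Fin K ⊕ A =>
    s.restrict (s.domain ∩ {z | StrictMono fun i => aeval z (P (σ i))})
      (s.isSemialgebraic_domain.inter (isSemialgebraic_cell P σ)) inter_subset_left with hpiece
  set good := fun σ : Fin (Fintype.card (Fin K ⊕ A)) ≃ Fin K ⊕ A =>
    ∀ q ∈ C, ∃ x₁ x₂ : Fin K ⊕ A, Sum.map id Subtype.val x₁ = q.1 ∧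
      Sum.map id Subtype.val x₂ = q.2 ∧ σ.symm x₁ < σ.symm x₂ with hgood_def
  have hgood : ∀ σ, good σ → ∃ c ∈ AddSubgroup.closure G, KZ.of (piece σ) - c ∈ KZ.relations := by
    intro σ hσ
    obtain ⟨lo', hi', hEq⟩ := exists_inter_chain_eq' pv A C σ hσ hlu
    refine HG (Fintype.card (Fin K ⊕ A)) (piece σ) (fun i =>
      if h : i.val + 1 < Fintype.card (Fin K ⊕ A) then
        Sum.elim (fun _ => ((0 : Fin (b + 1) → ℚ), (1 : ℚ))) (fun d => Sum.elim (fun _ => (0, 1))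
          (fun d' => (d'.1 - d.1, d'.2 - d.2)) (Sum.map id Subtype.val (σ ⟨i.val + 1, h⟩)))
          (Sum.map id Subtype.val (σ i)) else (0, 1))
      (fun v => Sum.map id Subtype.val (lo' v)) (fun v => Sum.map id Subtype.val (hi' v))
      (hbd.subset inter_subset_left) ?_ (hint.mono inter_subset_left)
    show s.domain ∩ {z | StrictMono fun i => aeval z (P (σ i))} = _
    rw [hdom, hcell σ, hEq]
    ext z
    simp only [mem_setOf_eq, gDom]
    refine and_congr ⟨fun h j => ?_, fun h i hi d d' h1 h2 => ?_⟩ Iff.rfl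
    · by_cases hj : j.val + 1 < Fintype.card (Fin K ⊕ A)
      · rw [dif_pos hj]
        rcases h1 : Sum.map id Subtype.val (σ j) with v | d
        · simp
        · rcases h2 : Sum.map id Subtype.val (σ ⟨j.val + 1, hj⟩) with v' | d'
          · simp
          · have hlt := h j hj d d' h1 h2
            simp only [Sum.elim_inr, Pi.sub_apply, sub_row_pos_iff]
            exact hlt
      · rw [dif_neg hj]
        simp
    · have hr := h i
      rw [dif_pos hi, h1, h2] at hr
      simp only [Sum.elim_inr, Pi.sub_apply, sub_row_pos_iff] at hr
      exact hr
  have hbad : ∀ σ, ¬ good σ → KZ.of (piece σ) ∈ KZ.relations := by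
    intro σ hσ
    refine KZ.of_mem_relations_of_volume_eq_zero _ ?_
    show volume (s.domain ∩ {z | StrictMono fun i => aeval z (P (σ i))}) = 0
    rw [hdom, hcell σ, inter_chain_eq_empty pv A C hA σ hσ, measure_empty]
  have hall : ∀ σ, ∃ c ∈ AddSubgroup.closure G, KZ.of (piece σ) - c ∈ KZ.relations := fun σ => by
    by_cases hσ : good σ
    · exact hgood σ hσ
    · exact RebaseNest.good_of_mem_relations (hbad σ hσ)
  exact RebaseNest.good_of_sub_mem hsplit (RebaseNest.good_sum _ _ fun σ _ => hall σ)

end Cells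

section Any

variable {m m' n₁ n₂ : ℕ}

/-- A literal domain one of whose fibres is bounded by ITSELF is empty. -/
theorem gDom_self_empty (M : Fin m' → Cf) (lo hi : Fin 2 → Fin 2 ⊕ Cf) (i : Fin 2)
    (h : lo i = Sum.inl i ∨ hi i = Sum.inl i) (z : Fin (0 + 1 + 2) → ℝ) : z ∉ gDom 0 2 m' M lo hi := by
  rintro ⟨-, hz⟩
  obtain ⟨h1, h2⟩ := hz i
  rcases h with h | h
  · rw [h] at h1; exact lt_irrefl _ h1
  · rw [h] at h2; exact lt_irrefl _ h2

/-- **Every literal cell with common-slope letters is good.** A representation with a literal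
`GS 0 2` datum (simple base pole `n₂ = 1`, `n₁ = 0`, two fibres, ANY bound pattern) whose letters
have a common `y`-slope is good for `GG 0 2 2`: with a mutual bound it is the landed
`rebaseSimpleZero_nestedCommonMain`, without it is the landed product case
(`RebaseZero.good_literal`), and a self-bounded fibre makes the domain empty.
[Kontsevich–Zagier 2001, §1.2] -/
theorem good_any (s : KZ.IntegralRep (0 + 1 + 2)) (M : Fin m' → Cf) (L : Fin m → (Fin 0 → ℚ) × ℚ)
    (e : Fin m → ℕ) (p : MvPolynomial (Fin 0) ℚ) (ℓ₁ ℓ₂ : (Fin 0 → ℚ) × ℚ) (a : Fin 2 → Option Cf)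
    (lo hi : Fin 2 → Fin 2 ⊕ Cf) (h1 : n₁ = 0) (hn : n₂ = 1)
    (hlam : ∃ lam : ℚ, ∀ i c, a i = some c → c.1 (Fin.last 0) = lam)
    (hbd : Bornology.IsBounded s.domain) (hdom : s.domain = gDom 0 2 m' M lo hi)
    (hint : EqOn s.integrand (glit 0 2 p L e ℓ₁ ℓ₂ n₁ n₂ a) s.domain) : Good 2 (KZ.of s) := by
  by_cases hnest : ∃ i j : Fin 2, i ≠ j ∧ (hi i = Sum.inl j ∨ lo j = Sum.inl i)
  · exact rebaseSimpleZero_nestedCommonMain m m' n₁ n₂ s M L e p ℓ₁ ℓ₂ a lo hi (Or.inl h1) hn hbd hdom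
      hint hnest hlam
  by_cases hself : ∃ i : Fin 2, lo i = Sum.inl i ∨ hi i = Sum.inl i
  · obtain ⟨i, hi0⟩ := hself
    exact good_of_dom_empty s fun z hz => gDom_self_empty M lo hi i hi0 z (hdom ▸ hz)
  push Not at hnest hself
  refine good_literal s M L e p ℓ₁ ℓ₂ a lo hi (Or.inl h1) (fun i => ⟨?_, ?_⟩) hbd hdom hint
  · rcases h : lo i with j | c
    · by_cases hij : j = i
      · subst hij; exact absurd h (hself j).1
      · exact absurd h (hnest j i hij).2
    · exact ⟨c, rfl⟩
  · rcases h : hi i with j | c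
    · by_cases hij : i = j
      · subst hij; exact absurd h (hself i).2
      · exact absurd h (hnest i j hij).1
    · exact ⟨c, rfl⟩

/-- **Order-constrained representations with common-slope letters are good.** A bounded
representation over the one-dimensional base `y` with two fibres whose domain is cut out by
finitely many strict comparisons between players (every fibre compared from below and from
above) and whose integrand is the literal `GS 0 2` integrand (simple base pole) with letters
of a common `y`-slope is good for `GG 0 2 2`. [Kontsevich–Zagier 2001, §1.2, rules (1a), (2)] -/
theorem good_constraints (s : KZ.IntegralRep (0 + 1 + 2)) (C : Finset ((Fin 2 ⊕ Cf) × (Fin 2 ⊕ Cf)))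
    (L : Fin m → (Fin 0 → ℚ) × ℚ) (e : Fin m → ℕ) (p : MvPolynomial (Fin 0) ℚ) (ℓ₁ ℓ₂ : (Fin 0 → ℚ) × ℚ)
    (a : Fin 2 → Option Cf) (h1 : n₁ = 0) (hn : n₂ = 1)
    (hlam : ∃ lam : ℚ, ∀ i c, a i = some c → c.1 (Fin.last 0) = lam)
    (hbd : Bornology.IsBounded s.domain)
    (hlu : ∀ v, (∃ q ∈ C, q.2 = Sum.inl v) ∧ (∃ q ∈ C, q.1 = Sum.inl v))
    (hdom : s.domain = {z | ∀ q ∈ C, pv q.1 z < pv q.2 z})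
    (hint : EqOn s.integrand (glit 0 2 p L e ℓ₁ ℓ₂ n₁ n₂ a) s.domain) : Good 2 (KZ.of s) :=
  goodCells s C L e p ℓ₁ ℓ₂ a hbd hlu hdom hint _ fun _ s' M lo hi hbd' hdom' hint' =>
    good_any s' M L e p ℓ₁ ℓ₂ a lo hi h1 hn hlam hbd' hdom' hint'

end Any

end RebaseDiff

/-- **Registered brick `rebaseSimpleZero_goodCells` of the part `rebaseSimpleZero_nestedDifferent`
(stub `stub_rebaseSimpleZeroTwo`, line `janus-bands`).** A bounded representation over the
one-dimensional base `y` with two fibres whose domain is cut out by finitely many strict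
comparisons between players (fibres and affine forms of `y`; every fibre compared from below
and from above) and whose integrand is the literal `GS 0 2` integrand (simple base pole,
`n₁ = 0`, `n₂ = 1`) with letters of a common `y`-slope is congruent modulo `KZ.relations` to
the subgroup generated by the literal rebased class `GG 0 2 2` (`RebaseDiff.good_constraints`:
total-order refinement into literal cells, each of which is the landed nested common-slope
case, the landed product case, or empty). [Kontsevich–Zagier 2001, §1.2, rules (1a), (2)] -/
theorem rebaseSimpleZero_goodCells (m n₁ n₂ : ℕ) (s : KZ.IntegralRep (0 + 1 + 2)) (C : Finset ((Fin 2 ⊕ ((Fin (0 + 1) → ℚ) × ℚ)) × (Fin 2 ⊕ ((Fin (0 + 1) → ℚ) × ℚ)))) (L : Fin m → (Fin 0 → ℚ) × ℚ) (e : Fin m → ℕ) (p : MvPolynomial (Fin 0) ℚ) (ℓ₁ ℓ₂ : (Fin 0 → ℚ) × ℚ) (a : Fin 2 → Option ((Fin (0 + 1) → ℚ) × ℚ)) (h1 : n₁ = 0) (hn : n₂ = 1) (hlam : ∃ lam : ℚ, ∀ i c, a i = some c → c.1 (Fin.last 0) = lam) (hbd : Bornology.IsBounded s.domain) (hlu :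 ∀ v, (∃ q ∈ C, q.2 = Sum.inl v) ∧ (∃ q ∈ C, q.1 = Sum.inl v)) (hdom : s.domain = {z | ∀ q ∈ C, RebasePos.pv q.1 z < RebasePos.pv q.2 z}) (hint : EqOn s.integrand (RebasePos.glit 0 2 p L e ℓ₁ ℓ₂ n₁ n₂ a) s.domain) : ∃ c ∈ AddSubgroup.closure (SeparatePos.GGset 0 2 2), KZ.of s - c ∈ KZ.relations :=
  RebaseDiff.good_constraints s C L e p ℓ₁ ℓ₂ a h1 hn hlam hbd hlu hdom hint

end Summit.KontsevichZagierPeriods.ArrangementNormalForm.JanusBands
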